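import Summits.HodgeConjecture.HodgeConjecture.Theorems.Q8SymplecticPowersFamilyDeck
import HarnessLib

/-!
# K1Q skeleton `mechanism-v2` (v5, sha256 b06e69e8…): stub S6 `stub_familyDeckExistsQ` — BY-NAME closer

Route `HodgeConjecture/Q8SymplecticPowers`, crux K1Q `VeryGeneralQuaternionCommutatorsInHg` (stmt-HodgeConjecture-24190), registered line
`mechanism-v2`, skeleton v5 (planner hodge-nonav-p3 g37, registered 2026-08-29T13:16Z). The registered stub S6 reads, verbatim,
`Kollar2007_resolutionLiftsAutomorphisms → ∀ e even ≥ 4, <the Q8FamilyDeck ∃-package>`; it is exactly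
`Q8SymplecticPowersFamilyDeck.stub_familyDeckExistsQ_of_kollar` (prover seat hodge-nonav-prover-Bx g19, programme M1, p722308) with the
`open … in` moved in front of the Kollár binder. This file restates it under the registered NAME and SIGNATURE so the skeleton registry can retire S6.

Honest scope: one stub of a skeleton, conditional on the named fact `Kollar2007_resolutionLiftsAutomorphisms` exactly as registered; K1Q and HC are NOT proved here.
-/

set_option linter.dupNamespace false

namespace Summit.HodgeConjecture.HodgeConjecture.Theorems.Q8SymplecticPowersStubFamilyDeckExistsQ

/-- **S6 `stub_familyDeckExistsQ` of skeleton v5, verbatim** (by-name closer; proof = `stub_familyDeckExistsQ_of_kollar`, p722308).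
[cite: Kollar2007, Thm. 3.36 and §3.4.1] [cite: EGAIV3, Thm. 8.10.5] -/
theorem stub_familyDeckExistsQ :
    open Literature.AlgebraicGeometry.Motives Literature.AlgebraicGeometry.HodgeTheory Literature.AlgebraicGeometry.HodgeTheory.BettiUniverse Literature.AlgebraicGeometry.HodgeTheory.Q8Family Literature.AlgebraicGeometry.RelativeSpec Literature.AlgebraicGeometry.RelativeSpec.ActionOver Literature.Algebra.Lie Literature.Algebra.Lie.KatzRecognition CategoryTheory CategoryTheory.Limits MonoidalCategory CartesianMonoidalCategory AlgebraicGeometry in Literature.AlgebraicGeometry.Resolution.Kollar2007_resolutionLiftsAutomorphisms.{0} → ∀ ⦃e : ℕ⦄, Even e → 4 ≤ e → ∃ (W : (Spec (.of (ParamRing e))).Opens) (𝒳 : SchemeOver ℂ) (π : 𝒳 ⟶ base W) (τ j : 𝒳 ⟶ 𝒳) (ι : (deckChart (fun i => (MvPolynomial.X i : ParamRing e)) ⊗ Over.mk W.ι).left ⟶ 𝒳.left), Nonempty (ComplexPoints (base W)) ∧ IsSmoothProjectiveFamily π 2 ∧ IsQuasiProjectiveOver 𝒳 ∧ IsQuasiProjectiveOver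 (base W) ∧ AlgebraicGeometry.SmoothOfRelativeDimension (Fintype.card (CIdx e)) (base W).hom ∧ (τ ≫ π = π ∧ j ≫ π = π ∧ τ ≫ τ ≫ τ ≫ τ = 𝟙 𝒳 ∧ j ≫ j = τ ≫ τ ∧ τ ≫ j ≫ τ = j) ∧ IsOpenImmersion ι ∧ ι ≫ π.left = (snd (deckChart (fun i => (MvPolynomial.X i : ParamRing e))) (Over.mk W.ι)).left ∧ ((Over.isoMk ((deckAction (fun i => (MvPolynomial.X i : ParamRing e))).aut (QuaternionGroup.a 1)) ((deckAction (fun i => (MvPolynomial.X i : ParamRing e))).aut_comp (QuaternionGroup.a 1))).hom ▷ Over.mk W.ι).left ≫ ι = ι ≫ τ.left ∧ ((Over.isoMk ((deckAction (fun i => (MvPolynomial.X i : ParamRing e))).aut (QuaternionGroup.xa 0)) ((deckAction (fun i => (MvPolynomial.X i : ParamRing e))).aut_comp (QuaternionGroup.xa 0))).hom ▷ Over.mk W.ι).left ≫ ι = ι ≫ j.left ∧ Function.Surjective (snd (deckChart (fun i => (MvPolynomial.X i : ParamRing e))) (Over.mk W.ι)).left :=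
  fun hK _e he h4 => Summit.HodgeConjecture.HodgeConjecture.Theorems.Q8SymplecticPowersFamilyDeck.stub_familyDeckExistsQ_of_kollar hK he h4

end Summit.HodgeConjecture.HodgeConjecture.Theorems.Q8SymplecticPowersStubFamilyDeckExistsQ
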